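import Summits.QuantumFields.YangMills.Theorems.FluctuationComparisonRegPrIntLS2BetaLoopWordCommutators
import Summits.QuantumFields.YangMills.Theorems.FluctuationComparisonRegPrIntLS2BetaChartReadDerivCovLinAvg
import Summits.QuantumFields.YangMills.Theorems.FluctuationComparisonRegPrIntLS2BetaChartReadOscSplit
import Literature.MathematicalPhysics.QuantumFieldTheory.Balaban1983to89.B7Eq31BCH
import Literature.MathematicalPhysics.QuantumFieldTheory.Balaban1983to89.BlockAveragingSU2FirstOrder
import Literature.MathematicalPhysics.QuantumFieldTheory.Balaban1983to89.LatticeWordStokes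
import HarnessLib

/-!
# S2β · (β-3)′ FILE B₂ — CONST AT THE FLAT BACKGROUND: THE SYMMETRIC COMB KILLS THE SECOND VARIATION.
# `‖↑(ψ_1(X̄) c) − ↑((Dψ_1(0) X̄) c)‖ ≤ (ℓ‖A‖)³` for direction-constant `X̄ b = A b.dir` — NO second-order term; with ✓p833442 (FILE A):
# `‖↑(ψ_1(X) c) − ↑((Dψ_1(0) X) c)‖ ≤ 8B·OSC²∕(a − ‖A‖)² + 32B·OSC·‖A‖∕a² + (ℓ‖A‖)³`, `OSC = ‖X − X̄‖`

Cell `ym3-torus` (YM ladder rung R3 = continuum `SU(2)` Yang–Mills on the three-torus at fixed lattice data — a RUNG: NOT d = 4, NOT infinite volume, NOT a mass gap,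
NOT Clay).  Width seat `ym3-torus-px13` (gen 27); crux `stmt-QuantumFields-20520`, LINE g18-1 S2β, pairing lane; (SCT″-c)₁ source budget (S-SRC).  ARCHITECT RULING px17 g22 19:55:50Z
«(β-3)′ YES»: the cure of HAZARD «SRC-q (2)» (px13 g27: the ADDITIVE order-2 Cauchy remainder `q·M²` of ✓(β-3) piles up `log N` on smooth small-amplitude relative data) is the ORDER-2 BRICK
IN OSCILLATION + BACKGROUND-CURVATURE FORM.  ✓p833442 (FILE A) reduced it to ONE structural letter CONST on (covariantly) constant fields; THIS FILE proves CONST at the FLAT background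
`U₀ = 1` (the background-curvature term is then absent): the remainder on a direction-constant field is CUBIC.  `--kind proof --supports stmt-QuantumFields-20520 --as helper`,
count-neutral, DEFINITION-FREE (0 `def`, 0 `instance`, 0 `notation`, 0 `sorry`, default heartbeats; whole file ≈ 18 s on the farm); generic `P : Params`, `SU(N)`, N09 chart-read conventions of ✓(β-1)∕(β-2)∕(β-3)∕(β-4)∕(D1).

THE MECHANISM (print: [Balaban1985Averaging] Prop. 3 (121)–(125) p.36 — the linearisation `Q₁^{R₀}` of the (0.4) average and the second-order remainder; [Balaban1987RG1] (0.3)–(0.4)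
pp.252–253 — the loop words `Γ^σ ∪ [x,x′] ∪ (−Γ^{σ′}) ∪ (−c)` over the SYMMETRIC index set `I = {offsets} × S_d × S_d`).  At `U₀ = 1` with `X̄⟨x,κ⟩ = A_κ` every loop matrix is an
ordered product `W_i = Π e^{±A_κ}` along a CLOSED word, so (lit ✓`Beta.TransportVertices`, [Balaban1985BackgroundPropagators] (3.6)) `W_i − 1 = quad_i + O(s³)` with `2·quad_i =
(Σ letters)² + commSum_i = commSum_i` (zero letter sum), `s = ℓ‖A‖`; and `Σ_{i∈I} commSum_i = 0` EXACTLY: `commSum(loop_{(n,σ,σ′)}) = C(σ,n) − C(σ′,n) + 2(ν_nτ − τν_n)` (FILE B₁), the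
staircase parts cancel under `σ ↔ σ′` (lit ✓`sum_idx_swap`) and `Σ_n ν_n = 0` because the centred offsets have mean zero (`L` odd; lit ✓`idxRefl`∕`off_revAt`) (FILE B₁).  Hence
`mean_i log W_i = O(s³)` (§1: `log W − (W − 1) = O(s⁴)`, lit ✓`norm_mlog_sub_sub_one_le_sq`), `eml(W) = exp(O(s³))` (lit ✓`eml_eq_exp`), `Ū(1) = 1` (lit ✓`avgFun_one`), the straight
segment is `e^{L•A_μ}`, so `ψ_1(X̄)c = log(e^{O(s³)}·e^{L•A_μ}) = L•A_μ + O(s³)` (lit ✓`B7Eq31BCH.eq31_of_sum_le`); and `Dψ_1(0)X̄ c = Q₁^{R₀}(1)X̄ c` (✓(D1) `norm_fderiv_chartRead_sub_covLinAvgR0_le`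
at `α = 0`) `= L•A_μ` EXACTLY (FILE B₁ `covLinAvgR0_one_dirConst`).

WHAT IS PROVED (sorry-free; the word∕list algebra — zero letter sums, `commSum(loop_i)`, `Σ_i commSum = 0`, `Q₁^{R₀}(1)X̄ = L•A_μ` — is FILE B₁ ✓`…S2BetaLoopWordCommutators`, BY NAME).
§1 `holonomy_sub_one_eq`, `norm_holonomy_rem_le`, ★★`norm_meanLog_holonomy_le` (abstract: zero sums + cancelling commutator sums ⟹ `‖mean log Πe^{b}‖ ≤ (11∕20)s³`, `s ≤ 1∕100`),
`norm_mlog_exp_mul_exp_sub_right_le`.  §2 `stepC_one`, `prod_map_stepC_one_walk` (flat loop matrices = lit `holonomy` of the signed letter list).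
§3 ★★★`norm_chartRead_sub_fderiv_le_const_flat` (the title; polydisc `100ℓ(e^{‖A‖} − 1) ≤ ρ ≤ innerRadius`).
§4 ★★★`norm_chartRead_sub_fderiv_le_flat_osc` (FILE A ∘ FILE B at `U₀ = 1`: oscillation + cubic, display above; `0 < a`, `100ℓ(e^a − 1) ≤ ρ`, `8‖A‖ ≤ a`, `4‖X − X̄‖ + ‖X̄‖ ≤ a`).

HONEST.  Elementary word∕list algebra and landed lit engines (`Beta.TransportVertices`, `B7Eq31BCH`, `MatrixLog`, `BlockAveragingEMLLinearised(Background)`, `T3DescentFibreTower`) composed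
with ✓(β-2)∕✓(D1)∕✓p833442; nothing of Bałaban's is asserted beyond what is proved here; CONST at a CURVED background (FILE C: covariantly constant `X̄`, background-curvature term
`M²·κ(U₀)`), the OSC-lift letter, (RSP-Σ), (BKG), rows v2, (ST‴), (SCT″-c)₁₂₃, LOC‴, GAP♯∘ (`stub_uniformFibreGapOrbit`, registry 3732b7df UNTOUCHED, 0∕5), the five REGISTERED stubs, S2β,
crux 20520, 19936, 19200, `YM3TorusSU2` — NOT proved; rung R3 = SU(2) YM₃ on T³ — NOT d = 4, NOT infinite volume, NOT a mass gap, NOT Clay; the Yang–Mills mass gap is NOT proved.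
Axioms standard.

References: [Balaban1985Averaging] T. Bałaban, CMP **98** (1985) 17–51, (21) p.21, (31) p.22, Prop. 3 (121)–(125) p.36, Prop. 4 (148)–(149) p.40; [Balaban1987RG1] CMP **109** (1987)
249–301, (0.3)–(0.4) pp.252–253; [Balaban1985BackgroundPropagators] CMP **99** (1985) 389–434, (3.6) p.391; [Balaban1984PropagatorsI] CMP **95** (1984) 17–40, (1.8) p.19.
-/

set_option autoImplicit false

noncomputable section

open scoped Matrix.Norms.L2Operator Topology
open Filter Set Function Metric

namespace Summit.QuantumFields.YangMills.Theorems.FluctuationComparisonRegPrIntLS2BetaChartReadConstFlat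

open Literature.MathematicalPhysics.QuantumFieldTheory.Balaban1983to89
open Literature.MathematicalPhysics.QuantumFieldTheory.Balaban1983to89.T4Continuum (walk holAt LStep loopWord netDisp Letter stairWord wordRev)
open Literature.MathematicalPhysics.QuantumFieldTheory.Balaban1983to89.Beta.TransportVertices (holonomy size quad commSum)
open MatrixLog (mlog)
open Summit.QuantumFields.YangMills.Theorems.FluctuationComparisonRegPrIntLS2BetaLoopWordCommutators

/-! ## §1 The mean of the loop logarithms is THIRD order when the letter sums vanish and the commutator sums cancel in the mean -/

section MeanLog

variable {𝔸 : Type*} [NormedRing 𝔸] [NormedAlgebra ℂ 𝔸] [CompleteSpace 𝔸]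

omit [CompleteSpace 𝔸] in
/-- Zero letter sum: the ordered product minus one is half the commutator sum plus the cubic Taylor remainder. [cite: Balaban1985BackgroundPropagators, (3.6) p.391] -/
theorem holonomy_sub_one_eq (l : List 𝔸) (h0 : l.sum = 0) :
    holonomy l - 1 = (2 : ℂ)⁻¹ • commSum l + (holonomy l - 1 - l.sum - quad ℂ l) := by
  have h2 := Beta.TransportVertices.two_smul_quad ℂ l
  rw [h0, mul_zero, zero_add] at h2
  have hq : quad ℂ l = (2 : ℂ)⁻¹ • commSum l := by rw [← h2, inv_smul_smul₀ two_ne_zero]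
  rw [hq, h0, sub_zero]
  abel

/-- The cubic Taylor remainder of an ordered product, monotone form: `size l ≤ s ⟹ ‖Πe^{b_j} − 1 − Σb_j − quad‖ ≤ s³e^s∕6`. [folklore] -/
theorem norm_holonomy_rem_le (l : List 𝔸) {s : ℝ} (hs : size l ≤ s) :
    ‖holonomy l - 1 - l.sum - quad ℂ l‖ ≤ s ^ 3 / 6 * Real.exp s := by
  have h0 : 0 ≤ size l := Beta.TransportVertices.size_nonneg l
  refine (Beta.TransportVertices.norm_holonomy_sub_taylor_two_le' ℂ l).trans ?_
  have h1 : size l ^ 3 ≤ s ^ 3 := pow_le_pow_left₀ h0 hs 3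
  have h2 : Real.exp (size l) ≤ Real.exp s := Real.exp_le_exp.2 hs
  have hs0 : 0 ≤ s := h0.trans hs
  exact mul_le_mul (by linarith) h2 (Real.exp_pos _).le (by positivity)

/-- ★★ **THE MEAN OF THE LOGARITHMS IS CUBIC.**  For a finite family of letter lists with zero letter sums, sizes `≤ s ≤ 1∕100`, whose commutator sums CANCEL IN THE SUM,
`‖|I|⁻¹ Σ_i log Πe^{b^{(i)}_j}‖ ≤ (11∕20)·s³` (`log` = the series `mlog`; per index `W_i − 1 = ½commSum_i + O(s³)`, `log W_i − (W_i − 1) = O(s⁴)`). [cite: Balaban1985Averaging, (21) p.21, Prop. 3 (121)-(123) p.36] -/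
theorem norm_meanLog_holonomy_le {ι : Type*} [Fintype ι] [Nonempty ι] (l : ι → List 𝔸) {s : ℝ} (hs0 : 0 ≤ s) (hs : s ≤ 1 / 100)
    (hsize : ∀ i, size (l i) ≤ s) (hsum : ∀ i, (l i).sum = 0) (hcomm : ∑ i, commSum (l i) = 0) :
    ‖((Fintype.card ι : ℂ))⁻¹ • ∑ i, mlog (holonomy (l i))‖ ≤ 11 / 20 * s ^ 3 := by
  have he : Real.exp s ≤ 3 :=
    (Real.exp_le_exp.2 (hs.trans (by norm_num))).trans (le_of_lt (lt_trans Real.exp_one_lt_d9 (by norm_num)))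
  have hs3 : 0 ≤ s ^ 3 := pow_nonneg hs0 3
  -- per index
  have hR : ∀ i, ‖holonomy (l i) - 1 - (l i).sum - quad ℂ (l i)‖ ≤ s ^ 3 / 2 := fun i =>
    (norm_holonomy_rem_le (l i) (hsize i)).trans (by nlinarith)
  have hW : ∀ i, ‖holonomy (l i) - 1‖ ≤ s ^ 2 := fun i => by
    have h0 : 0 ≤ size (l i) := Beta.TransportVertices.size_nonneg (l i)
    have hq : ‖quad ℂ (l i)‖ ≤ s ^ 2 / 2 :=
      (Beta.TransportVertices.norm_quad_le ℂ (l i)).trans (by have := pow_le_pow_left₀ h0 (hsize i) 2; linarith)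
    have hdec : holonomy (l i) - 1 = quad ℂ (l i) + (holonomy (l i) - 1 - (l i).sum - quad ℂ (l i)) := by rw [hsum i, sub_zero]; abel
    rw [hdec]
    refine (norm_add_le _ _).trans ?_
    have hs32 : s ^ 3 ≤ s ^ 2 := by nlinarith
    linarith [hR i]
  have hlog : ∀ i, ‖mlog (holonomy (l i)) - (holonomy (l i) - 1)‖ ≤ s ^ 4 := fun i => by
    have h12 : ‖holonomy (l i) - 1‖ ≤ 1 / 2 := (hW i).trans (by nlinarith)
    calc ‖mlog (holonomy (l i)) - (holonomy (l i) - 1)‖ ≤ ‖holonomy (l i) - 1‖ ^ 2 := MatrixLog.norm_mlog_sub_sub_one_le_sq h12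
      _ ≤ (s ^ 2) ^ 2 := pow_le_pow_left₀ (norm_nonneg _) (hW i) 2
      _ = s ^ 4 := by ring
  -- the sum: the commutator means cancel
  have hdecomp : ∑ i, mlog (holonomy (l i)) =
      ∑ i, ((mlog (holonomy (l i)) - (holonomy (l i) - 1)) + (holonomy (l i) - 1 - (l i).sum - quad ℂ (l i))) + (2 : ℂ)⁻¹ • ∑ i, commSum (l i) := by
    rw [Finset.smul_sum, ← Finset.sum_add_distrib]
    refine Finset.sum_congr rfl fun i _ => ?_
    have h := holonomy_sub_one_eq (l i) (hsum i)
    rw [hsum i, sub_zero] at h ⊢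
    have h' : quad ℂ (l i) = (2 : ℂ)⁻¹ • commSum (l i) := by
      have := congrArg (fun x => x - (holonomy (l i) - 1 - quad ℂ (l i))) h
      simp only [add_sub_cancel_right] at this
      rw [← this]; abel
    rw [h']; abel
  rw [hdecomp, hcomm, smul_zero, add_zero]
  have hcard : (0 : ℝ) < Fintype.card ι := Nat.cast_pos.2 Fintype.card_pos
  have hS : ‖∑ i, ((mlog (holonomy (l i)) - (holonomy (l i) - 1)) + (holonomy (l i) - 1 - (l i).sum - quad ℂ (l i)))‖ ≤
      Fintype.card ι * (s ^ 4 + s ^ 3 / 2) := by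
    refine (norm_sum_le _ _).trans ?_
    have hterm : ∀ i ∈ (Finset.univ : Finset ι), ‖(mlog (holonomy (l i)) - (holonomy (l i) - 1)) + (holonomy (l i) - 1 - (l i).sum - quad ℂ (l i))‖ ≤ s ^ 4 + s ^ 3 / 2 :=
      fun i _ => (norm_add_le _ _).trans (add_le_add (hlog i) (hR i))
    refine (Finset.sum_le_sum hterm).trans ?_
    rw [Finset.sum_const, Finset.card_univ, nsmul_eq_mul]
  rw [norm_smul, norm_inv, Complex.norm_natCast]
  calc (Fintype.card ι : ℝ)⁻¹ * ‖∑ i, ((mlog (holonomy (l i)) - (holonomy (l i) - 1)) + (holonomy (l i) - 1 - (l i).sum - quad ℂ (l i)))‖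
      ≤ (Fintype.card ι : ℝ)⁻¹ * (Fintype.card ι * (s ^ 4 + s ^ 3 / 2)) := mul_le_mul_of_nonneg_left hS (inv_nonneg.2 hcard.le)
    _ = s ^ 4 + s ^ 3 / 2 := by field_simp
    _ ≤ 11 / 20 * s ^ 3 := by nlinarith


/-- First-order BCH read as «`log(e^E e^T) = T + O(‖E‖)`»: `‖log(e^E e^T) − T‖ ≤ ‖E‖·(1 + 2‖T‖)` on `‖E‖ + ‖T‖ ≤ 1∕5` (lit ✓`B7Eq31BCH.eq31_of_sum_le`). [cite: Balaban1985Averaging, (31) p.22] -/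
theorem norm_mlog_exp_mul_exp_sub_right_le [NormOneClass 𝔸] {E T : 𝔸} (h : ‖E‖ + ‖T‖ ≤ 1 / 5) :
    ‖mlog (NormedSpace.exp E * NormedSpace.exp T) - T‖ ≤ ‖E‖ * (1 + 2 * ‖T‖) := by
  have h1 := B7Eq31BCH.eq31_of_sum_le h
  have h2 : mlog (NormedSpace.exp E * NormedSpace.exp T) - T = (mlog (NormedSpace.exp E * NormedSpace.exp T) - E - T) + E := by abel
  rw [h2]
  refine (norm_add_le _ _).trans ?_
  nlinarith [norm_nonneg E, norm_nonneg T]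

end MeanLog

/-! ## §2 The flat background: loop matrices are ordered products `Πe^{±A_κ}` of the signed letter lists -/

section FlatSteps

open Literature.MathematicalPhysics.QuantumFieldTheory.Balaban1983to89.Node00

variable {P : Params} {j : ℕ} {N : ℕ} [NeZero N]

/-- At the flat background the complexified step factor of the chart point `e^{Y}·1` is `e^{±Y_b}`. [cite: Balaban1987RG1, (0.4) p.253] -/
theorem stepC_one (Y : PBond P j → Matrix (Fin N) (Fin N) ℂ) (s : LStep P j) :
    (if s.fwd then NormedSpace.exp (Y s.bond) * (((1 : GaugeField P j (SU N)) s.bond : SU N) : Matrix (Fin N) (Fin N) ℂ)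
      else star (((1 : GaugeField P j (SU N)) s.bond : SU N) : Matrix (Fin N) (Fin N) ℂ) * NormedSpace.exp (-(Y s.bond))) =
      NormedSpace.exp (if s.fwd then Y s.bond else -(Y s.bond)) := by
  have h1 : (((1 : GaugeField P j (SU N)) s.bond : SU N) : Matrix (Fin N) (Fin N) ℂ) = 1 := rfl
  rw [h1, star_one, mul_one, one_mul]
  cases s.fwd <;> simp

/-- Along a walk at the flat background with direction-constant data the step product is the ordered product `Π e^{±a_κ}` of the signed letter list. [cite: Balaban1987RG1, (0.4) p.253] -/
theorem prod_map_stepC_one_walk (a : Fin P.d → Matrix (Fin N) (Fin N) ℂ) (x : Site P j) (w : List (Letter P.d)) :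
    ((walk x w).map (fun s : LStep P j => if s.fwd then NormedSpace.exp ((fun b : PBond P j => a b.dir) s.bond) * (((1 : GaugeField P j (SU N)) s.bond : SU N) : Matrix (Fin N) (Fin N) ℂ)
      else star (((1 : GaugeField P j (SU N)) s.bond : SU N) : Matrix (Fin N) (Fin N) ℂ) * NormedSpace.exp (-((fun b : PBond P j => a b.dir) s.bond)))).prod =
      holonomy (w.map (fun l => if l.2 then a l.1 else -(a l.1))) := by
  have h : (fun s : LStep P j => if s.fwd then NormedSpace.exp ((fun b : PBond P j => a b.dir) s.bond) * (((1 : GaugeField P j (SU N)) s.bond : SU N) : Matrix (Fin N) (Fin N) ℂ)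
      else star (((1 : GaugeField P j (SU N)) s.bond : SU N) : Matrix (Fin N) (Fin N) ℂ) * NormedSpace.exp (-((fun b : PBond P j => a b.dir) s.bond))) =
      (fun s : LStep P j => (fun μ b => NormedSpace.exp (if b then a μ else -(a μ))) s.bond.dir s.fwd) := by
    funext s
    exact stepC_one (fun b : PBond P j => a b.dir) s
  rw [h, map_walk_eq_map (fun μ b => NormedSpace.exp (if b then a μ else -(a μ))) x w, Beta.TransportVertices.holonomy, List.map_map]
  rfl

end FlatSteps

/-! ## §3 CONST AT THE FLAT BACKGROUND -/

section Main

open Literature.MathematicalPhysics.QuantumFieldTheory.Balaban1983to89.HaarExponentialChart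
open Literature.MathematicalPhysics.QuantumFieldTheory.Balaban1983to89.HaarExponentialChart.IsChartRep
open Literature.MathematicalPhysics.QuantumFieldTheory.Balaban1983to89.BlockAveraging (Idx avgFun loopHol off)
open Literature.MathematicalPhysics.QuantumFieldTheory.Balaban1983to89.ExpMeanLog (eml expMeanLogSU deltaSU deltaSU_pos eml_eq_exp)
open Literature.MathematicalPhysics.QuantumFieldTheory.Balaban1983to89.Node00
open Literature.MathematicalPhysics.QuantumFieldTheory.Balaban1983to89.BlockAveragingEMLLinearisedBackground (covLinAvgR0)
open Summit.QuantumFields.YangMills.Theorems.FluctuationComparisonRegPrIntLS2BetaChartReadCplxExtension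
open Summit.QuantumFields.YangMills.Theorems.FluctuationComparisonRegPrIntLS2BetaChartReadCplxAnalytic
open Summit.QuantumFields.YangMills.Theorems.FluctuationComparisonRegPrIntLS2BetaChartReadDerivCovLinAvg

variable {P : Params} {j : ℕ} {N : ℕ} [NeZero N]

/-- ★★★ **CONST AT THE FLAT BACKGROUND — THE SYMMETRIC COMB KILLS THE SECOND VARIATION.**  At `U₀ = 1`, for a direction-constant perturbation `X̄ b = A (b.dir)`
(`A : Fin d → 𝔰𝔲(N)`) on the polydisc `100ℓ(e^{‖A‖} − 1) ≤ ρ ≤ innerRadius` (`ℓ = (d+2)L`):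
`‖↑(ψ_1(X̄) c) − ↑((Dψ_1(0) X̄) c)‖ ≤ (ℓ‖A‖)³` — NO second-order term.  Mechanism: the loop matrices are `W_i = Πe^{±A_κ}` along the CLOSED loop words, so
`W_i − 1 = ½commSum_i + O(s³)` (lit ✓`Beta.TransportVertices`), and `Σ_i commSum_i = 0` over the (0.4) index set (`σ ↔ σ′` symmetry + centred offsets, §5); hence
`eml(W) = exp(O(s³))`, `ψ_1(X̄)c = log(e^{O(s³)}e^{L•A_μ}) = L•A_μ + O(s³)` (lit ✓`eq31_of_sum_le`), while `Dψ_1(0)X̄ c = Q₁^{R₀}(1)X̄ c = L•A_μ` EXACTLY (✓(D1) at `α = 0`, §5).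
[cite: Balaban1985Averaging, Prop. 3 (121)-(125) p.36; Balaban1987RG1, (0.3)-(0.4) pp.252-253] -/
theorem norm_chartRead_sub_fderiv_le_const_flat {ρ : ℝ} (hρ0 : 0 < ρ) (hρ : ρ ≤ innerRadius (specialUnitaryLogChart (Fin N)))
    (A : Fin P.d → (specialUnitaryLogChart (Fin N)).lie) (hA : 100 * ((((P.d + 2) * P.L : ℕ) : ℝ) * (Real.exp ‖A‖ - 1)) ≤ ρ) (c : PBond P (j + 1)) :
    ‖((((fun (X : PBond P j → (specialUnitaryLogChart (Fin N)).lie) (c : PBond P (j + 1)) => (isChartRep_specialUnitaryGroup (n := Fin N)).logChart (avgFun (expMeanLogSU (n := Fin N)) (fun b => (isChartRep_specialUnitaryGroup (n := Fin N)).expChart (X b) * (1 : GaugeField P j (SU N)) b) c * (avgFun (expMeanLogSU (n := Fin N)) (1 : GaugeField P j (SU N)) c)⁻¹))) (fun b => A b.dir) c : (specialUnitaryLogChart (Fin N)).lie) : Matrix (Fin N) (Fin N) ℂ) -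
        ((fderiv ℝ (fun (X : PBond P j → (specialUnitaryLogChart (Fin N)).lie) (c : PBond P (j + 1)) => (isChartRep_specialUnitaryGroup (n := Fin N)).logChart (avgFun (expMeanLogSU (n := Fin N)) (fun b => (isChartRep_specialUnitaryGroup (n := Fin N)).expChart (X b) * (1 : GaugeField P j (SU N)) b) c * (avgFun (expMeanLogSU (n := Fin N)) (1 : GaugeField P j (SU N)) c)⁻¹)) 0 (fun b => A b.dir) c : (specialUnitaryLogChart (Fin N)).lie) : Matrix (Fin N) (Fin N) ℂ)‖ ≤
      ((((P.d + 2) * P.L : ℕ) : ℝ) * ‖A‖) ^ 3 := by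
  -- sizes
  have hℓ0 : (0 : ℝ) ≤ (((P.d + 2) * P.L : ℕ) : ℝ) := Nat.cast_nonneg _
  have hM0 : 0 ≤ ‖A‖ := norm_nonneg A
  have hs0 : 0 ≤ (((P.d + 2) * P.L : ℕ) : ℝ) * ‖A‖ := mul_nonneg hℓ0 hM0
  have hρ3 : ρ ≤ 1 / 3 := hρ.trans innerRadius_le_third
  have hexpM : ‖A‖ ≤ Real.exp ‖A‖ - 1 := by linarith [Real.add_one_le_exp ‖A‖]
  have hs : (((P.d + 2) * P.L : ℕ) : ℝ) * ‖A‖ ≤ 1 / 100 := by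
    have : (((P.d + 2) * P.L : ℕ) : ℝ) * ‖A‖ ≤ (((P.d + 2) * P.L : ℕ) : ℝ) * (Real.exp ‖A‖ - 1) := mul_le_mul_of_nonneg_left hexpM hℓ0
    linarith
  have hLℓ : (P.L : ℝ) ≤ (((P.d + 2) * P.L : ℕ) : ℝ) := by
    have : P.L ≤ (P.d + 2) * P.L := Nat.le_mul_of_pos_left _ (by omega)
    exact_mod_cast this
  -- the flat loop guard and the field
  have hα : ∀ (c' : PBond P (j + 1)) (i : Idx P), dist1 (loopHol (1 : GaugeField P j (SU N)) c' i) ≤ 0 := fun c' i => by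
    rw [T3DescentFibreTower.loopHol_one, GaugeGroup.dist1_one]
  have hα4 : 4 * (0 : ℝ) ≤ ρ := by linarith
  have hXA : ‖(fun b : PBond P j => A b.dir)‖ ≤ ‖A‖ := (pi_norm_le_iff_of_nonneg hM0).2 fun b => norm_le_pi_norm A b.dir
  have hX : 100 * ((((P.d + 2) * P.L : ℕ) : ℝ) * (Real.exp ‖(fun b : PBond P j => A b.dir)‖ - 1)) ≤ ρ := by
    have hmono : Real.exp ‖(fun b : PBond P j => A b.dir)‖ - 1 ≤ Real.exp ‖A‖ - 1 := by linarith [Real.exp_le_exp.2 hXA]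
    exact le_trans (by gcongr) hA
  -- (1) the real slice (✓(β-2))
  have hψ := coe_chartRead_eq_cplxChartRead (1 : GaugeField P j (SU N)) c hρ (hα c) hα4 hρ0 (fun b : PBond P j => A b.dir) hX
  -- (2) the derivative is `L • A_μ` (✓(D1) at `α = 0`, §5)
  have hD := norm_fderiv_chartRead_sub_covLinAvgR0_le (1 : GaugeField P j (SU N)) hα (by norm_num) deltaSU_pos (fun b : PBond P j => A b.dir) c
  rw [mul_zero, zero_mul] at hD
  have hDeq := sub_eq_zero.1 (norm_le_zero_iff.1 hD)
  have hQ : covLinAvgR0 (1 : GaugeField P j (SU N)) (fun b : PBond P j => ((A b.dir : (specialUnitaryLogChart (Fin N)).lie) : Matrix (Fin N) (Fin N) ℂ)) c =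
      P.L • ((A c.dir : (specialUnitaryLogChart (Fin N)).lie) : Matrix (Fin N) (Fin N) ℂ) :=
    covLinAvgR0_one_dirConst (fun κ => ((A κ : (specialUnitaryLogChart (Fin N)).lie) : Matrix (Fin N) (Fin N) ℂ)) c
  have hDT := hDeq.trans hQ
  -- (3) the loop lists: zero sums, sizes, cancelling commutator means (§3, §5)
  have hsum : ∀ i : Idx P, ((loopWord P.L c.dir (off i.1) i.2.1 i.2.2).map (fun l => if l.2 then ((A l.1 : (specialUnitaryLogChart (Fin N)).lie) : Matrix (Fin N) (Fin N) ℂ) else -((A l.1 : (specialUnitaryLogChart (Fin N)).lie) : Matrix (Fin N) (Fin N) ℂ))).sum = 0 :=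
    fun i => sum_map_signed_loopWord (fun κ => ((A κ : (specialUnitaryLogChart (Fin N)).lie) : Matrix (Fin N) (Fin N) ℂ)) _ _ _ _
  have hcomm := sum_idx_commSum_loop_eq_zero (P := P) (fun κ => ((A κ : (specialUnitaryLogChart (Fin N)).lie) : Matrix (Fin N) (Fin N) ℂ)) c.dir
  have hsize : ∀ i : Idx P, size ((loopWord P.L c.dir (off i.1) i.2.1 i.2.2).map (fun l => if l.2 then ((A l.1 : (specialUnitaryLogChart (Fin N)).lie) : Matrix (Fin N) (Fin N) ℂ) else -((A l.1 : (specialUnitaryLogChart (Fin N)).lie) : Matrix (Fin N) (Fin N) ℂ))) ≤ (((P.d + 2) * P.L : ℕ) : ℝ) * ‖A‖ := by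
    intro i
    have hent : ∀ b ∈ (loopWord P.L c.dir (off i.1) i.2.1 i.2.2).map (fun l => if l.2 then ((A l.1 : (specialUnitaryLogChart (Fin N)).lie) : Matrix (Fin N) (Fin N) ℂ) else -((A l.1 : (specialUnitaryLogChart (Fin N)).lie) : Matrix (Fin N) (Fin N) ℂ)), ‖b‖ ≤ ‖A‖ := by
      intro b hb
      obtain ⟨l, -, rfl⟩ := List.mem_map.1 hb
      have h1 : ‖((A l.1 : (specialUnitaryLogChart (Fin N)).lie) : Matrix (Fin N) (Fin N) ℂ)‖ ≤ ‖A‖ := by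
        rw [Submodule.norm_coe]; exact norm_le_pi_norm A l.1
      split_ifs
      · exact h1
      · rw [norm_neg]; exact h1
    refine (Beta.TransportVertices.size_le_length_mul _ hent).trans ?_
    rw [List.length_map]
    have hlen : (((loopWord P.L c.dir (off i.1) i.2.1 i.2.2).length : ℕ) : ℝ) ≤ (((P.d + 2) * P.L : ℕ) : ℝ) := by
      exact_mod_cast LatticeWordStokes.length_loopWord_le c i
    exact mul_le_mul_of_nonneg_right hlen hM0
  have hE := norm_meanLog_holonomy_le (fun i : Idx P => (loopWord P.L c.dir (off i.1) i.2.1 i.2.2).map (fun l => if l.2 then ((A l.1 : (specialUnitaryLogChart (Fin N)).lie) : Matrix (Fin N) (Fin N) ℂ) else -((A l.1 : (specialUnitaryLogChart (Fin N)).lie) : Matrix (Fin N) (Fin N) ℂ))) hs0 hs hsize hsum hcomm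
  -- (4) the straight segment and the flat base
  letI : NormedAlgebra ℚ (Matrix (Fin N) (Fin N) ℂ) := NormedAlgebra.restrictScalars ℚ ℂ (Matrix (Fin N) (Fin N) ℂ)
  have hS := prod_map_stepC_one_walk (N := N) (fun κ => ((A κ : (specialUnitaryLogChart (Fin N)).lie) : Matrix (Fin N) (Fin N) ℂ)) (emb c.src) (List.replicate P.L (c.dir, true))
  rw [map_signed_replicate (fun κ => ((A κ : (specialUnitaryLogChart (Fin N)).lie) : Matrix (Fin N) (Fin N) ℂ)) P.L c.dir true, if_pos rfl,
    Beta.TransportVertices.holonomy, List.map_replicate, List.prod_replicate, ← NormedSpace.exp_nsmul] at hS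
  have h1 : (((avgFun (expMeanLogSU (n := Fin N)) (1 : GaugeField P j (SU N)) c : SU N) : Matrix (Fin N) (Fin N) ℂ)) = 1 := by
    rw [T3DescentFibreTower.avgFun_one _ T3DescentFibreTower.expMeanLogSU_E_one]; rfl
  -- (5) `ψ_1(X̄)c = log(e^E e^T)`
  have hΦ : ((((fun (X : PBond P j → (specialUnitaryLogChart (Fin N)).lie) (c : PBond P (j + 1)) => (isChartRep_specialUnitaryGroup (n := Fin N)).logChart (avgFun (expMeanLogSU (n := Fin N)) (fun b => (isChartRep_specialUnitaryGroup (n := Fin N)).expChart (X b) * (1 : GaugeField P j (SU N)) b) c * (avgFun (expMeanLogSU (n := Fin N)) (1 : GaugeField P j (SU N)) c)⁻¹))) (fun b => A b.dir) c : (specialUnitaryLogChart (Fin N)).lie) : Matrix (Fin N) (Fin N) ℂ) =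
      mlog (NormedSpace.exp (((Fintype.card (Idx P) : ℂ))⁻¹ • ∑ i : Idx P, mlog (holonomy ((loopWord P.L c.dir (off i.1) i.2.1 i.2.2).map (fun l => if l.2 then ((A l.1 : (specialUnitaryLogChart (Fin N)).lie) : Matrix (Fin N) (Fin N) ℂ) else -((A l.1 : (specialUnitaryLogChart (Fin N)).lie) : Matrix (Fin N) (Fin N) ℂ))))) *
        NormedSpace.exp (P.L • ((A c.dir : (specialUnitaryLogChart (Fin N)).lie) : Matrix (Fin N) (Fin N) ℂ))) := by
    refine hψ.trans ?_
    rw [h1, star_one, mul_one, eml_eq_exp]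
    refine congrArg mlog (congrArg₂ (· * ·) (congrArg NormedSpace.exp (congrArg (fun x => ((Fintype.card (Idx P) : ℂ))⁻¹ • x)
      (Finset.sum_congr rfl fun i _ => congrArg mlog ?_))) hS)
    exact prod_map_stepC_one_walk (N := N) (fun κ => ((A κ : (specialUnitaryLogChart (Fin N)).lie) : Matrix (Fin N) (Fin N) ℂ)) (emb c.src) (loopWord P.L c.dir (off i.1) i.2.1 i.2.2)
  -- (6) the estimate
  have hs31 : ((((P.d + 2) * P.L : ℕ) : ℝ) * ‖A‖) ^ 3 ≤ (((P.d + 2) * P.L : ℕ) : ℝ) * ‖A‖ := by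
    have h2 : ((((P.d + 2) * P.L : ℕ) : ℝ) * ‖A‖) ^ 2 ≤ 1 := by nlinarith
    calc ((((P.d + 2) * P.L : ℕ) : ℝ) * ‖A‖) ^ 3 = ((((P.d + 2) * P.L : ℕ) : ℝ) * ‖A‖) ^ 2 * ((((P.d + 2) * P.L : ℕ) : ℝ) * ‖A‖) := by ring
      _ ≤ 1 * ((((P.d + 2) * P.L : ℕ) : ℝ) * ‖A‖) := mul_le_mul_of_nonneg_right h2 hs0
      _ = _ := one_mul _
  have hT : ‖P.L • ((A c.dir : (specialUnitaryLogChart (Fin N)).lie) : Matrix (Fin N) (Fin N) ℂ)‖ ≤ (((P.d + 2) * P.L : ℕ) : ℝ) * ‖A‖ := by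
    refine norm_nsmul_le.trans ?_
    rw [Submodule.norm_coe]
    exact mul_le_mul hLℓ (norm_le_pi_norm A c.dir) (norm_nonneg _) hℓ0
  have hfin := norm_mlog_exp_mul_exp_sub_right_le (𝔸 := Matrix (Fin N) (Fin N) ℂ)
    (E := ((Fintype.card (Idx P) : ℂ))⁻¹ • ∑ i : Idx P, mlog (holonomy ((loopWord P.L c.dir (off i.1) i.2.1 i.2.2).map (fun l => if l.2 then ((A l.1 : (specialUnitaryLogChart (Fin N)).lie) : Matrix (Fin N) (Fin N) ℂ) else -((A l.1 : (specialUnitaryLogChart (Fin N)).lie) : Matrix (Fin N) (Fin N) ℂ)))))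
    (T := P.L • ((A c.dir : (specialUnitaryLogChart (Fin N)).lie) : Matrix (Fin N) (Fin N) ℂ)) (by linarith [hE, hT, hs31])
  have hfin' : ‖mlog (NormedSpace.exp (((Fintype.card (Idx P) : ℂ))⁻¹ • ∑ i : Idx P, mlog (holonomy ((loopWord P.L c.dir (off i.1) i.2.1 i.2.2).map (fun l => if l.2 then ((A l.1 : (specialUnitaryLogChart (Fin N)).lie) : Matrix (Fin N) (Fin N) ℂ) else -((A l.1 : (specialUnitaryLogChart (Fin N)).lie) : Matrix (Fin N) (Fin N) ℂ))))) *
        NormedSpace.exp (P.L • ((A c.dir : (specialUnitaryLogChart (Fin N)).lie) : Matrix (Fin N) (Fin N) ℂ))) - P.L • ((A c.dir : (specialUnitaryLogChart (Fin N)).lie) : Matrix (Fin N) (Fin N) ℂ)‖ ≤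
      ((((P.d + 2) * P.L : ℕ) : ℝ) * ‖A‖) ^ 3 := by
    refine hfin.trans ?_
    have hEn := hE
    have hTn := hT
    have h3 : 0 ≤ ((((P.d + 2) * P.L : ℕ) : ℝ) * ‖A‖) ^ 3 := pow_nonneg hs0 3
    nlinarith [norm_nonneg (P.L • ((A c.dir : (specialUnitaryLogChart (Fin N)).lie) : Matrix (Fin N) (Fin N) ℂ)),
      norm_nonneg (((Fintype.card (Idx P) : ℂ))⁻¹ • ∑ i : Idx P, mlog (holonomy ((loopWord P.L c.dir (off i.1) i.2.1 i.2.2).map (fun l => if l.2 then ((A l.1 : (specialUnitaryLogChart (Fin N)).lie) : Matrix (Fin N) (Fin N) ℂ) else -((A l.1 : (specialUnitaryLogChart (Fin N)).lie) : Matrix (Fin N) (Fin N) ℂ)))))]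
  rw [hΦ, hDT]
  exact hfin'

end Main

/-! ## §4 (β-3)′ AT THE FLAT BACKGROUND: OSCILLATION + CUBIC (FILE A ∘ FILE B) -/

section FlatOsc

open Literature.MathematicalPhysics.QuantumFieldTheory.Balaban1983to89.HaarExponentialChart
open Literature.MathematicalPhysics.QuantumFieldTheory.Balaban1983to89.HaarExponentialChart.IsChartRep
open Literature.MathematicalPhysics.QuantumFieldTheory.Balaban1983to89.BlockAveraging (Idx avgFun loopHol off)
open Literature.MathematicalPhysics.QuantumFieldTheory.Balaban1983to89.ExpMeanLog (expMeanLogSU)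
open Literature.MathematicalPhysics.QuantumFieldTheory.Balaban1983to89.Node00
open Summit.QuantumFields.YangMills.Theorems.FluctuationComparisonRegPrIntLS2BetaChartReadCplxExtension
open Summit.QuantumFields.YangMills.Theorems.FluctuationComparisonRegPrIntLS2BetaChartReadOscSplit

variable {P : Params} {j : ℕ} {N : ℕ} [NeZero N]

/-- ★★★ **(β-3)′ AT THE FLAT BACKGROUND — THE ORDER-2 BRICK IN OSCILLATION FORM**: at `U₀ = 1`, for any `X` and any direction data `A : Fin d → 𝔰𝔲(N)` with reference field
`X̄ b = A b.dir` (polydisc `0 < a`, `100ℓ(e^a − 1) ≤ ρ ≤ innerRadius`, `8‖A‖ ≤ a`, `4‖X − X̄‖ + ‖X̄‖ ≤ a`; `B = 54ℓ(e^a − 1)`):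
`‖↑(ψ_1(X) c) − ↑((Dψ_1(0) X) c)‖ ≤ 8B·‖X − X̄‖²∕(a − ‖A‖)² + 32B·‖X − X̄‖·‖A‖∕a² + (ℓ‖A‖)³` — the second-order remainder is priced by the OSCILLATION `‖X − X̄‖` and a CUBIC
term only (✓p833442 `norm_chartRead_sub_fderiv_le_of_split` ∘ `norm_chartRead_sub_fderiv_le_const_flat`). [cite: Balaban1985Averaging, Prop. 3 (121)-(125) p.36, Prop. 4 (148)-(149) p.40] -/
theorem norm_chartRead_sub_fderiv_le_flat_osc {ρ : ℝ} (hρ0 : 0 < ρ) (hρ : ρ ≤ innerRadius (specialUnitaryLogChart (Fin N)))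
    {a : ℝ} (ha0 : 0 < a) (ha : 100 * ((((P.d + 2) * P.L : ℕ) : ℝ) * (Real.exp a - 1)) ≤ ρ)
    (A : Fin P.d → (specialUnitaryLogChart (Fin N)).lie) (hAa : 8 * ‖A‖ ≤ a)
    (X : PBond P j → (specialUnitaryLogChart (Fin N)).lie) (hX : 4 * ‖X - (fun b => A b.dir)‖ + ‖(fun b : PBond P j => A b.dir)‖ ≤ a) (c : PBond P (j + 1)) :
    ‖((((fun (X : PBond P j → (specialUnitaryLogChart (Fin N)).lie) (c : PBond P (j + 1)) => (isChartRep_specialUnitaryGroup (n := Fin N)).logChart (avgFun (expMeanLogSU (n := Fin N)) (fun b => (isChartRep_specialUnitaryGroup (n := Fin N)).expChart (X b) * (1 : GaugeField P j (SU N)) b) c * (avgFun (expMeanLogSU (n := Fin N)) (1 : GaugeField P j (SU N)) c)⁻¹))) X c : (specialUnitaryLogChart (Fin N)).lie) : Matrix (Fin N) (Fin N) ℂ) -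
        ((fderiv ℝ (fun (X : PBond P j → (specialUnitaryLogChart (Fin N)).lie) (c : PBond P (j + 1)) => (isChartRep_specialUnitaryGroup (n := Fin N)).logChart (avgFun (expMeanLogSU (n := Fin N)) (fun b => (isChartRep_specialUnitaryGroup (n := Fin N)).expChart (X b) * (1 : GaugeField P j (SU N)) b) c * (avgFun (expMeanLogSU (n := Fin N)) (1 : GaugeField P j (SU N)) c)⁻¹)) 0 X c : (specialUnitaryLogChart (Fin N)).lie) : Matrix (Fin N) (Fin N) ℂ)‖ ≤
      8 * (54 * ((((P.d + 2) * P.L : ℕ) : ℝ) * (Real.exp a - 1))) * ‖X - (fun b => A b.dir)‖ ^ 2 / (a - ‖A‖) ^ 2 +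
        32 * (54 * ((((P.d + 2) * P.L : ℕ) : ℝ) * (Real.exp a - 1))) * ‖X - (fun b => A b.dir)‖ * ‖A‖ / a ^ 2 +
        ((((P.d + 2) * P.L : ℕ) : ℝ) * ‖A‖) ^ 3 := by
  have hℓ0 : (0 : ℝ) ≤ (((P.d + 2) * P.L : ℕ) : ℝ) := Nat.cast_nonneg _
  have hM0 : 0 ≤ ‖A‖ := norm_nonneg A
  have hXA : ‖(fun b : PBond P j => A b.dir)‖ ≤ ‖A‖ := (pi_norm_le_iff_of_nonneg hM0).2 fun b => norm_le_pi_norm A b.dir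
  have hα : ∀ (c' : PBond P (j + 1)) (i : Idx P), dist1 (loopHol (1 : GaugeField P j (SU N)) c' i) ≤ 0 := fun c' i => by
    rw [T3DescentFibreTower.loopHol_one, GaugeGroup.dist1_one]
  have hα4 : 4 * (0 : ℝ) ≤ ρ := by linarith
  have hAρ : 100 * ((((P.d + 2) * P.L : ℕ) : ℝ) * (Real.exp ‖A‖ - 1)) ≤ ρ := by
    have hmono : Real.exp ‖A‖ - 1 ≤ Real.exp a - 1 := by linarith [Real.exp_le_exp.2 (show ‖A‖ ≤ a by linarith)]
    exact le_trans (by gcongr) ha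
  have hsplit := norm_chartRead_sub_fderiv_le_of_split (1 : GaugeField P j (SU N)) hρ0 hρ hα hα4 ha0 ha X (fun b => A b.dir) (by linarith) hX c
  have hconst := norm_chartRead_sub_fderiv_le_const_flat (P := P) (j := j) hρ0 hρ A hAρ c
  have hB0 : 0 ≤ 54 * ((((P.d + 2) * P.L : ℕ) : ℝ) * (Real.exp a - 1)) := by
    have : 0 ≤ Real.exp a - 1 := by linarith [Real.add_one_le_exp a]
    positivity
  have hAa' : ‖A‖ < a := by linarith
  have h1 := cauchy_bound_mono (a := a) (nv := ‖X - (fun b => A b.dir)‖) hB0 (norm_nonneg (X - (fun b => A b.dir))) le_rfl hXA hAa'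
  have h2 : 32 * (54 * ((((P.d + 2) * P.L : ℕ) : ℝ) * (Real.exp a - 1))) * ‖X - (fun b => A b.dir)‖ * ‖(fun b : PBond P j => A b.dir)‖ / a ^ 2 ≤
      32 * (54 * ((((P.d + 2) * P.L : ℕ) : ℝ) * (Real.exp a - 1))) * ‖X - (fun b => A b.dir)‖ * ‖A‖ / a ^ 2 := by
    refine div_le_div_of_nonneg_right ?_ (pow_pos ha0 2).le
    exact mul_le_mul_of_nonneg_left hXA (by positivity)
  linarith [hsplit, hconst, h1, h2]

end FlatOsc

end Summit.QuantumFields.YangMills.Theorems.FluctuationComparisonRegPrIntLS2BetaChartReadConstFlat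

end
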